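import Mathlib
import Summits.NavierStokesRegularity.NavierStokesRegularity.Theorems.FilamentSkeletonRssClause13KernelMothers
import Summits.NavierStokesRegularity.NavierStokesRegularity.Theorems.FilamentSkeletonRssClause13PieceSymbolFacts

/-!
# Clause 13-J/13-R, brick n3 (KERNEL PROFILE FACTS): from the profile identities of the six kernels to the symbol hypotheses of `model_l2_estimate`

Route `FilamentSkeletonRss`, ∃-side clause 13 (`Clause13RNearStraightL` stmt-NavierStokesRegularity-23612; typing-agnostic).  The model theorem
(`model_l2_estimate`, p709153) asks, for each kernel, only a statement of the form «profile `≠ 0` (resp. `≠ 1`) at `z` ⟹ the symbol `𝔖(z√q)` /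
`𝔖′(z√q)` has the right sign and size».  Given the profile identities delivered by the kernel packages (`∫ k e^{izt} = P(y(z))` with an explicit
plateau `P` and a linear `y`), these follow from the plateau facts (`…Clause13ProfileBumps`) and the window facts (`…Clause13PieceSymbolFacts`):
`S0supp_of_profile` (`|z|√q ≤ x_s`), `S1sym_of_profile` (`(2/q)𝔖 ≤ −κ_S1`, `κ_S1 = (2/q)(x_s²/16)log(2/x_s)`), `band_of_profile` (`𝔖′ ≥ 153/4000`),
`MIDsym_of_profile` and `Tsym_of_profile` (`(2/q)/50 ≤ (2/q)𝔖`; the latter through the transition identity `∫(tk′+k)e^{izt} = −zF′(z)`),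
`Nfar_of_profile` (`X ≤ |z|√q`).  Inherits the certified-numerics axioms of the symbol windows (computational).
Lane ns-filament-19175-p1 g17; `--supports stmt-NavierStokesRegularity-23612 --as helper`.
HONEST FRAMING: bookkeeping for a HYPOTHETICAL filament skeleton's model operator on the NEGATIVE side of a MODEL route; nothing here bears on
Navier–Stokes regularity or blow-up.
-/

noncomputable section

open MeasureTheory Real Complex Filter Set
open scoped ComplexConjugate Topology
open Summit.NavierStokesRegularity.NavierStokesRegularity.Theorems.AnalyticStripLiaSymbol (liaSym liaSym_le_neg_S1 liaSym_ge_MID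
  deriv_liaSym_ge_band_const)

namespace Summit.NavierStokesRegularity.NavierStokesRegularity.Theorems.MatchedKernel
set_option linter.dupNamespace false

/-- **S0**: profile `P_{1,2}(y(z))` with `|y(z)| = (2√q/x_s)|z|` ⟹ (`≠ 0 ⟹ |z|√q ≤ x_s`). [folklore] -/
theorem S0supp_of_profile {k : ℝ → ℝ} {q xs : ℝ} (hxs : 0 < xs) {y : ℝ → ℝ}
    (hΦ : ∀ z : ℝ, ∫ t : ℝ, ((k t : ℝ) : ℂ) * cexp (I * z * t)
      = (((smoothTransition ((2 - y z) / (2 - 1)) + smoothTransition ((2 + y z) / (2 - 1)) - 1 : ℝ)) : ℂ))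
    (hy : ∀ z, |y z| = 2 * √q / xs * |z|) :
    ∀ z : ℝ, (∫ t : ℝ, ((k t : ℝ) : ℂ) * cexp (I * z * t)) ≠ 0 → |z| * √q ≤ xs := by
  intro z hz
  rw [hΦ z] at hz
  have h := abs_lt_of_plateau_ne_zero zero_le_one one_lt_two (Complex.ofReal_ne_zero.1 hz)
  rw [hy z, div_mul_eq_mul_div, div_lt_iff₀ hxs] at h
  nlinarith [Real.sqrt_nonneg q, abs_nonneg z]

/-- **S1**: profile `P_{17/20,19/20}(y₂(z)) − P_{1,2}(y₁(z))` with `|y₂(z)| = |z√q|`, `|y₁(z)| = (2/x_s)|z√q|`, `0 < x_s ≤ 1/10` ⟹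
(`≠ 0 ⟹ (2/q)𝔖(z√q) ≤ −(2/q)(x_s²/16)log(2/x_s)`). [folklore] -/
theorem S1sym_of_profile {k : ℝ → ℝ} {q xs : ℝ} (hq : 0 < q) (hxs : 0 < xs) (hxs' : xs ≤ 1 / 10) {y₂ y₁ : ℝ → ℝ}
    (hΦ : ∀ z : ℝ, ∫ t : ℝ, ((k t : ℝ) : ℂ) * cexp (I * z * t)
      = (((smoothTransition ((19 / 20 - y₂ z) / (19 / 20 - 17 / 20)) + smoothTransition ((19 / 20 + y₂ z) / (19 / 20 - 17 / 20)) - 1 : ℝ)) : ℂ)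
        - (((smoothTransition ((2 - y₁ z) / (2 - 1)) + smoothTransition ((2 + y₁ z) / (2 - 1)) - 1 : ℝ)) : ℂ))
    (hy₂ : ∀ z, |y₂ z| = |z * √q|) (hy₁ : ∀ z, |y₁ z| = 2 / xs * |z * √q|) :
    ∀ z : ℝ, (∫ t : ℝ, ((k t : ℝ) : ℂ) * cexp (I * z * t)) ≠ 0 → 2 / q * liaSym (z * √q) ≤ -(2 / q * (xs ^ 2 / 16 * Real.log (2 / xs))) := by
  intro z hz
  rw [hΦ z] at hz
  have hlo : xs / 2 < |z * √q| := by
    by_contra hc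
    push Not at hc
    have h1 : smoothTransition ((2 - y₁ z) / (2 - 1)) + smoothTransition ((2 + y₁ z) / (2 - 1)) - 1 = 1 :=
      plateau_eq_one one_lt_two (by rw [hy₁ z, div_mul_eq_mul_div, div_le_iff₀ hxs]; linarith)
    have h2 : smoothTransition ((19 / 20 - y₂ z) / (19 / 20 - 17 / 20)) + smoothTransition ((19 / 20 + y₂ z) / (19 / 20 - 17 / 20)) - 1 = 1 :=
      plateau_eq_one (by norm_num) (by rw [hy₂ z]; linarith)
    rw [h1, h2] at hz
    exact hz (by push_cast; ring)
  have hhi : |z * √q| < 19 / 20 := by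
    by_contra hc
    push Not at hc
    have h1 : smoothTransition ((2 - y₁ z) / (2 - 1)) + smoothTransition ((2 + y₁ z) / (2 - 1)) - 1 = 0 :=
      plateau_eq_zero zero_le_one one_lt_two (by
        rw [hy₁ z, div_mul_eq_mul_div, le_div_iff₀ hxs]
        nlinarith)
    have h2 : smoothTransition ((19 / 20 - y₂ z) / (19 / 20 - 17 / 20)) + smoothTransition ((19 / 20 + y₂ z) / (19 / 20 - 17 / 20)) - 1 = 0 :=
      plateau_eq_zero (by norm_num) (by norm_num) (by rw [hy₂ z]; exact hc)
    rw [h1, h2] at hz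
    exact hz (by push_cast; ring)
  have h := liaSym_le_neg_S1 hxs hxs' hlo.le hhi.le
  have hq' : 0 < 2 / q := by positivity
  nlinarith

/-- **BAND**: profile `V(z√q)` (the one-sided band) ⟹ (`≠ 0 ⟹ 153/4000 ≤ 𝔖′(z√q)`). [folklore] -/
theorem band_of_profile {a b : ℝ → ℝ} {q : ℝ} {y : ℝ → ℝ}
    (hΦ : ∀ z : ℝ, (∫ t : ℝ, ((a t : ℝ) : ℂ) * cexp (I * z * t)) + I * (∫ t : ℝ, ((b t : ℝ) : ℂ) * cexp (I * z * t))
      = (((smoothTransition ((18 / 5 - y z) / (18 / 5 - 7 / 2)) - smoothTransition ((19 / 20 - y z) / (19 / 20 - 17 / 20)) : ℝ)) : ℂ))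
    (hy : ∀ z, y z = z * √q) :
    ∀ z : ℝ, (∫ t : ℝ, ((a t : ℝ) : ℂ) * cexp (I * z * t)) + I * (∫ t : ℝ, ((b t : ℝ) : ℂ) * cexp (I * z * t)) ≠ 0 →
      153 / 4000 ≤ deriv liaSym (z * √q) := by
  intro z hz
  rw [hΦ z, hy z] at hz
  have h := mem_band_of_bandProfile_ne_zero (Complex.ofReal_ne_zero.1 hz)
  exact deriv_liaSym_ge_band_const h.1.le h.2.le

/-- **MID**: profile `P_{1,2}(y₄(z)) − P_{7/2,18/5}(y₃(z))` with `|y₄(z)| = |z√q|/X`, `|y₃(z)| = |z√q|`, `X ≥ 7/2` ⟹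
(`≠ 0 ⟹ (2/q)/50 ≤ (2/q)𝔖(z√q)`). [folklore] -/
theorem MIDsym_of_profile {k : ℝ → ℝ} {q X : ℝ} (hq : 0 < q) (hX : 7 / 2 ≤ X) {y₄ y₃ : ℝ → ℝ}
    (hΦ : ∀ z : ℝ, ∫ t : ℝ, ((k t : ℝ) : ℂ) * cexp (I * z * t)
      = (((smoothTransition ((2 - y₄ z) / (2 - 1)) + smoothTransition ((2 + y₄ z) / (2 - 1)) - 1 : ℝ)) : ℂ)
        - (((smoothTransition ((18 / 5 - y₃ z) / (18 / 5 - 7 / 2)) + smoothTransition ((18 / 5 + y₃ z) / (18 / 5 - 7 / 2)) - 1 : ℝ)) : ℂ))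
    (hy₄ : ∀ z, |y₄ z| = |z * √q| / X) (hy₃ : ∀ z, |y₃ z| = |z * √q|) :
    ∀ z : ℝ, (∫ t : ℝ, ((k t : ℝ) : ℂ) * cexp (I * z * t)) ≠ 0 → 2 / q * (1 / 50) ≤ 2 / q * liaSym (z * √q) := by
  intro z hz
  rw [hΦ z] at hz
  have hX0 : 0 < X := by linarith
  have hlo : 7 / 2 < |z * √q| := by
    by_contra hc
    push Not at hc
    have h1 : smoothTransition ((2 - y₄ z) / (2 - 1)) + smoothTransition ((2 + y₄ z) / (2 - 1)) - 1 = 1 :=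
      plateau_eq_one one_lt_two (by rw [hy₄ z, div_le_iff₀ hX0]; linarith)
    have h2 : smoothTransition ((18 / 5 - y₃ z) / (18 / 5 - 7 / 2)) + smoothTransition ((18 / 5 + y₃ z) / (18 / 5 - 7 / 2)) - 1 = 1 :=
      plateau_eq_one (by norm_num) (by rw [hy₃ z]; exact hc)
    rw [h1, h2] at hz
    exact hz (by push_cast; ring)
  have h := liaSym_ge_MID hlo.le
  exact mul_le_mul_of_nonneg_left h (by positivity)

/-- **NEAR**: profile `P_{1,2}(y(z))` with `|y(z)| = |z√q|/X` ⟹ (`≠ 1 ⟹ X ≤ |z|√q`). [folklore] -/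
theorem Nfar_of_profile {k : ℝ → ℝ} {q X : ℝ} (hX : 0 < X) {y : ℝ → ℝ}
    (hΦ : ∀ z : ℝ, ∫ t : ℝ, ((k t : ℝ) : ℂ) * cexp (I * z * t)
      = (((smoothTransition ((2 - y z) / (2 - 1)) + smoothTransition ((2 + y z) / (2 - 1)) - 1 : ℝ)) : ℂ))
    (hy : ∀ z, |y z| = |z * √q| / X) :
    ∀ z : ℝ, (∫ t : ℝ, ((k t : ℝ) : ℂ) * cexp (I * z * t)) ≠ 1 → X ≤ |z| * √q := by
  intro z hz
  rw [hΦ z] at hz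
  have hne : smoothTransition ((2 - y z) / (2 - 1)) + smoothTransition ((2 + y z) / (2 - 1)) - 1 ≠ 1 := fun h => hz (by rw [h]; push_cast; ring)
  have h := lt_abs_of_plateau_ne_one one_lt_two hne
  rw [hy z, lt_div_iff₀ hX, one_mul, abs_mul, abs_of_nonneg (Real.sqrt_nonneg q)] at h
  exact h.le

/-- **TRANSITION**: for `k ∈ C¹` with `k, t k, t k′ ∈ L¹` and profile `P_{1,2}(s·z)`, `|s| = √q/X`, `X ≥ 7/2`:
`∫(t k′ + k)e^{izt} ≠ 0 ⟹ (2/q)/50 ≤ (2/q)𝔖(z√q)` (the transform is `−z·s·P′(sz)`, supported in `X ≤ |z√q| ≤ 2X`). [folklore] -/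
theorem Tsym_of_profile {k k' : ℝ → ℝ} (hk : ∀ t, HasDerivAt k (k' t) t) (hki : Integrable k) (hk1 : Integrable fun t => t * k t)
    (hk'1 : Integrable fun t => t * k' t) {q X s : ℝ} (hq : 0 < q) (hX : 7 / 2 ≤ X) (hs : |s| = √q / X)
    (hΦ : ∀ z : ℝ, ∫ t : ℝ, ((k t : ℝ) : ℂ) * cexp (I * z * t)
      = (((smoothTransition ((2 - s * z) / (2 - 1)) + smoothTransition ((2 + s * z) / (2 - 1)) - 1 : ℝ)) : ℂ)) :
    ∀ z : ℝ, (∫ t : ℝ, (((t * k' t + k t : ℝ)) : ℂ) * cexp (I * z * t)) ≠ 0 → 2 / q * (1 / 50) ≤ 2 / q * liaSym (z * √q) := by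
  intro z hz
  have hX0 : 0 < X := by linarith
  set P : ℝ → ℝ := fun x : ℝ => smoothTransition ((2 - x) / (2 - 1)) + smoothTransition ((2 + x) / (2 - 1)) - 1 with hP
  -- the profile as a function of `z` and its derivative
  have hF : ∀ w : ℝ, ∫ t : ℝ, ((k t : ℝ) : ℂ) * cexp (I * w * t) = (fun w : ℝ => ((P (s * w) : ℝ) : ℂ)) w := fun w => by
    rw [hΦ w]
  have hlin : HasDerivAt (fun w : ℝ => s * w) s z := by simpa using (hasDerivAt_id z).const_mul s
  have hPd : HasDerivAt (fun w : ℝ => P (s * w)) (deriv P (s * z) * s) z := (hasDerivAt_plateau 1 2 (s * z)).comp z hlin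
  have hF' : HasDerivAt (fun w : ℝ => ((P (s * w) : ℝ) : ℂ)) (((deriv P (s * z) * s : ℝ)) : ℂ) z := by
    have := hPd.ofReal_comp; simpa using this
  have hT := unnormalisedTransform_transitionKernel hk hki hk1 hk'1 hF hF'
  rw [hT] at hz
  have hd : deriv P (s * z) ≠ 0 := by
    intro h0
    apply hz
    rw [h0]; push_cast; ring
  have hsupp := plateau_deriv_support zero_le_one one_lt_two hd
  have habs : |s * z| = |z * √q| / X := by
    rw [abs_mul, hs, abs_mul, abs_of_nonneg (Real.sqrt_nonneg q)]; ring
  have hlo : 7 / 2 ≤ |z * √q| := by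
    have h1 := hsupp.1
    rw [habs, le_div_iff₀ hX0] at h1
    linarith
  exact mul_le_mul_of_nonneg_left (liaSym_ge_MID hlo) (by positivity)

end Summit.NavierStokesRegularity.NavierStokesRegularity.Theorems.MatchedKernel

end
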